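import Mathlib.Algebra.Polynomial.HasseDeriv
import Mathlib.Algebra.Polynomial.Degree.Lemmas
import Mathlib.Algebra.CharZero.Defs
import HarnessLib

/-!
# Casas-Alvero polynomials: the definition, the conjecture as a named statement, and the
elementary normal-form facts behind the computational verifications

A monic polynomial `f` of degree `d` is a *Casas-Alvero polynomial* if for every `0 < i < d` it has a
common root with its `i`-th (Hasse) derivative [Casas-Alvero, J. Algebra 240 (2001) 326–337; survey:
Draisma–de Jong, EMS Newsl. 80 (2011) 29–33]. The CONJECTURE (not stated here as a declaration: it is
open, and conjectures live under `Summits/`, of which this problem has none) says such an `f` is `(X - a)^d`. Known for `d = p^k, 2p^k` [Graf von Bothmer–Labs–Schicho–van de Woestijne, J. Algebra 316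
(2007) 224–230], `d = 12` and `5p^k, 6p^k, 7p^k` off finite bad-prime sets [Castryck–Laterveer–Ounaïes,
Math. Comp. 83 (2014) 3017–3037]; smallest open degree `20` (2026).

PROVED here (folklore / Marashdeh, arXiv:2608.14726, Lemma 2.2 and Thm 3.1, the two facts every
case-by-case elimination uses):
* `hasseDeriv_eval_zero` — `(H_i f)(0) = [X^i] f`;
* `sharesRoot_of_coeff_eq_zero` — VACUITY: if `f(0) = 0` and `[X^i] f = 0` then `f` and `H_i f` share
  the root `0`, so in the centred normal form only the indices in the support impose conditions;
* `hasseDeriv_pred_natDegree_of_centred` — for monic `f` of degree `d ≥ 1` with `[X^(d-1)] f = 0`,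
  `H_{d-1} f = d • X`;
* `eval_zero_of_isCasasAlvero_of_centred` — hence, over a domain of characteristic `0`, a centred
  Casas-Alvero polynomial of degree `≥ 2` vanishes at `0` (the recycled root of order `d-1` is the
  centroid), which is what makes `0` a recycled root in every scenario of the degree-20/24 computations.
No `sorry`, no new axioms.
-/

noncomputable section

open Polynomial

namespace Literature.Algebra.Polynomial.CasasAlvero

variable {R : Type*} [CommRing R]

/-- `f` and `g` have a common root in `R`. [folklore] -/
def SharesRoot (f g : R[X]) : Prop := ∃ θ : R, f.eval θ = 0 ∧ g.eval θ = 0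

/-- `f` is a Casas-Alvero polynomial over `R`: for every `0 < i < natDegree f`, `f` and its `i`-th Hasse
derivative have a common root in `R` (take `R` algebraically closed for the classical notion; over a field of
characteristic `0` the Hasse derivative `H_i f = f^{(i)}/i!` has the same roots as `f^{(i)}`).
[cite: CastryckLaterveerOunaies2012, §1] -/
def IsCasasAlvero (f : R[X]) : Prop :=
  ∀ i : ℕ, 0 < i → i < f.natDegree → SharesRoot f (hasseDeriv i f)

/-- `(H_i f)(0)` is the coefficient of `X^i` in `f`. [folklore] -/
theorem hasseDeriv_eval_zero (i : ℕ) (f : R[X]) : (hasseDeriv i f).eval 0 = f.coeff i := by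
  rw [← coeff_zero_eq_eval_zero, hasseDeriv_coeff, zero_add, Nat.choose_self, Nat.cast_one, one_mul]

/-- VACUITY [cite: Marashdeh2026, Thm 3.1]: if `f(0) = 0` and `[X^i] f = 0`, then `f` and `H_i f` share the root `0`. -/
theorem sharesRoot_of_coeff_eq_zero {f : R[X]} (h0 : f.eval 0 = 0) {i : ℕ} (hi : f.coeff i = 0) :
    SharesRoot f (hasseDeriv i f) :=
  ⟨0, h0, by rw [hasseDeriv_eval_zero, hi]⟩

/-- For monic `f` of degree `d ≥ 1` with vanishing `X^(d-1)`-coefficient ("centred"), `H_{d-1} f = d • X`. [folklore] -/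
theorem hasseDeriv_pred_natDegree_of_centred {f : R[X]} (hf : f.Monic) (hd : 1 ≤ f.natDegree)
    (hc : f.coeff (f.natDegree - 1) = 0) :
    hasseDeriv (f.natDegree - 1) f = (f.natDegree : R[X]) * X := by
  ext n
  rw [hasseDeriv_coeff]
  rcases Nat.lt_trichotomy n 1 with hn | rfl | hn
  · have hn0 : n = 0 := by omega
    subst hn0
    simp [hc]
  · have h1 : 1 + (f.natDegree - 1) = f.natDegree := by omega
    rw [h1, hf.coeff_natDegree, mul_one]
    have h2 : (f.natDegree).choose (f.natDegree - 1) = f.natDegree := by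
      conv_rhs => rw [← Nat.choose_one_right f.natDegree]
      rw [← h1, Nat.choose_symm_add, h1]
    rw [h2]
    simp
  · have hgt : f.natDegree < n + (f.natDegree - 1) := by omega
    rw [coeff_eq_zero_of_natDegree_lt hgt, mul_zero]
    -- right-hand side: coefficient of `X^n` in `d * X` for `n ≥ 2`
    rw [← C_eq_natCast, coeff_C_mul, coeff_X]
    have : (1 : ℕ) ≠ n := by omega
    simp [if_neg this]

/-- Over a domain of characteristic `0`, a centred monic Casas-Alvero polynomial of degree `d ≥ 2` vanishes at `0`
(the condition of order `d-1` can only be realised by the centroid of the roots, which is `0`). [cite: Marashdeh2026, Lemma 2.2] -/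
theorem eval_zero_of_isCasasAlvero_of_centred [IsDomain R] [CharZero R] {f : R[X]} (hf : f.Monic)
    (hd : 2 ≤ f.natDegree) (hc : f.coeff (f.natDegree - 1) = 0) (hca : IsCasasAlvero f) :
    f.eval 0 = 0 := by
  obtain ⟨θ, hfθ, hHθ⟩ := hca (f.natDegree - 1) (by omega) (by omega)
  rw [hasseDeriv_pred_natDegree_of_centred hf (by omega) hc] at hHθ
  have hθ : θ = 0 := by
    have h : (f.natDegree : R) * θ = 0 := by
      simpa [eval_mul, eval_X] using hHθ
    rcases mul_eq_zero.mp h with h | h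
    · exact absurd h (by exact_mod_cast (show f.natDegree ≠ 0 by omega))
    · exact h
  simpa [hθ] using hfθ


end Literature.Algebra.Polynomial.CasasAlvero
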